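import Literature.AnabelianGeometry.SemiGraphs.PSCSeparatingCoveringsTwoComponentUnmarkedEdgesOneCusp
import HarnessLib

/-!
# [CombGC] Prop. 1.2, proof p. 9: the separating coverings AS PRINTED at every origin of two-component data with `C₁` UNMARKED (row F-2830, `r ≥ 1`)

Mochizuki, *A combinatorial version of the Grothendieck conjecture*, Tohoku Math. J. **59** (2007)
[CombGC], PROOF of Proposition 1.2, author's manuscript p. 9 [cite: MochizukiCombGC2007, Prop 1.2 proof p.9]:
the separating-coverings step over an origin predicate `Ω`, `PSCDatum.SeparatingCoveringsHolds Ω`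
(abc-iut-w4-d081, row P12-L01; abc-iut FACT-LIST row F-2830 — a schema whose universal closure is refuted as
typed; the instance forms at genuine carriers are the content), together with Prop. 1.2 (i)/(ii) as printed
(`OpenInterDeterminesComponentHolds Ω` = F-0459, `CommensurableTerminalityHolds Ω` = F-0438).

PROOF-ONLY file (abc-iut-f-166 gen 6, row «ONE-CUSP-CORNERS» (2), sequel of
`PSCSeparatingCoveringsTwoComponentUnmarkedEdgesOneCusp.lean`; 0 definitions): the origin of the data of
two-component shape with `C₁` UNMARKED (abc-iut-f-164 gen 2's origin hypothesis of
`PSCTwoComponentUnmarkedOrigin.lean` BY NAME, `r ≥ 1` marked points on `C₀`, stability side conditions,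
genera pinned; profinite `Π` in `Type`).  Gen 5's capstone `PSCTwoComponentUnmarkedProp12All.lean` had
F-2830 there for `r ≥ 2` only; the one-cusp edge theorem of the parent file removes that restriction.

* `twoComponentUnmarkedOrigin_separatingCoveringsHolds'` — **F-2830 at EVERY origin of unmarked-`C₁` data,
  `r ≥ 1`**; `twoComponentUnmarkedOrigin_prop12_rows'` — F-2830 ∧ F-0459 ∧ F-0438 there (the latter two gen
  5's `twoComponentUnmarkedOrigin_prop12_holds` BY NAME);
* `exists_twoComponentUnmarkedOrigin_prop12_rows_oneCusp` — NON-VACUITY at the corner: the origin of the data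
  `Γ_{2,1}` (genera `(1,1)`, the single marked point on `C₀`) is inhabited for every nonempty set `Σ` of
  primes (abc-iut-f-164's `exists_twoComponentAffineDatum`) and carries all three rows.

Instance forms at data of the shape of genuine two-component curves: consistency evidence for the typed
schemata, not the printed theorem for all pointed stable curves (cell FOUNDATIONS rows 13–14).  Nothing here
takes a side on [IUTchIII] Cor. 3.12.
-/

noncomputable section

namespace Literature.AnabelianGeometry.SemiGraphs

open scoped Pointwise
open Literature.GroupTheory.CombinatorialGroupTheory
open SemiGraphOfAnabelioids (IsProSigmaCompletion)

namespace PSCDatum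


/-! ### Origin level: F-2830 at every origin of unmarked-`C₁` data, `r ≥ 1` -/

section Origin

variable (Ω : PSCOrigin.{0})

/-- **Row F-2830 `SeparatingCoveringsHolds Ω` at EVERY origin whose data are of two-component shape with
`C₁` unmarked** — abc-iut-f-164 gen 2's origin hypothesis of `PSCTwoComponentUnmarkedOrigin.lean` BY NAME
(`r ≥ 1`; the `r = 1` origins are new). [cite: MochizukiCombGC2007, Prop 1.2 proof p.9] -/
theorem twoComponentUnmarkedOrigin_separatingCoveringsHolds'
    (hΩ : ∀ ⦃Q : Type⦄ [Group Q] [TopologicalSpace Q] [IsTopologicalGroup Q] (G : PSCDatum Q),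
      Ω.IsOfPSCType G → CompactSpace Q ∧ T2Space Q ∧ TotallyDisconnectedSpace Q ∧
        ∃ (S : Set ℕ) (g r g₀ s : ℕ) (ι : PuncturedSurfaceGroup g r →* Q) (e : G.graph.C ≃ Fin r)
          (v₀ v₁ : G.graph.V) (n₀ : G.graph.N) (ε : PuncturedSurfaceGroup g r),
          S.Nonempty ∧ (∀ p ∈ S, p.Prime) ∧ IsProSigmaCompletion S ι ∧ g₀ ≤ g ∧ s = 0 ∧ 1 ≤ r ∧
          (1 ≤ g₀ ∨ 2 ≤ r) ∧ 1 ≤ g - g₀ ∧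
          (∀ c, G.cuspGp c =
            ((PuncturedSurfaceGroup.cuspInertia (g := g) (e c)).map ι).topologicalClosure) ∧
          (∀ w, w = v₀ ∨ w = v₁) ∧ (∀ n, n = n₀) ∧
          ε = ((List.finRange r).map fun j : Fin r =>
            if s ≤ (j : ℕ) then PuncturedSurfaceGroup.c (g := g) j else 1).prod *
          ((List.finRange g).map fun i : Fin g => if (i : ℕ) < g₀ then
            PuncturedSurfaceGroup.a (r := r) i * PuncturedSurfaceGroup.b i *
              (PuncturedSurfaceGroup.a i)⁻¹ * (PuncturedSurfaceGroup.b i)⁻¹ else 1).prod ∧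
          G.vertGp v₀ = ((Subgroup.closure {x : PuncturedSurfaceGroup g r |
            (∃ i : Fin g, (i : ℕ) < g₀ ∧ (x = PuncturedSurfaceGroup.a i ∨ x = PuncturedSurfaceGroup.b i)) ∨
            ∃ j : Fin r, s ≤ (j : ℕ) ∧ x = PuncturedSurfaceGroup.c j}).map ι).topologicalClosure ∧
          G.vertGp v₁ = ((Subgroup.closure {x : PuncturedSurfaceGroup g r |
            (∃ i : Fin g, g₀ ≤ (i : ℕ) ∧ (x = PuncturedSurfaceGroup.a i ∨ x = PuncturedSurfaceGroup.b i)) ∨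
            (∃ j : Fin r, (j : ℕ) < s ∧ x = PuncturedSurfaceGroup.c j) ∨ x = ε}).map ι).topologicalClosure ∧
          G.nodeGp n₀ = ((Subgroup.zpowers ε).map ι).topologicalClosure ∧
          G.genus v₀ = g₀ ∧ G.genus v₁ = g - g₀) :
    SeparatingCoveringsHolds Ω := by
  intro Q _ _ _ G hG
  obtain ⟨hc, -, hd, S, g, r, g₀, s, ι, e, v₀, v₁, n₀, ε, hne, hprime, hι, hg₀, hs, hr, hst₀, hg₁, hC, hV,
    hN, hε, hV₀, hV₁, hE, hgen₀, hgen₁⟩ := hΩ G hG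
  haveI := hc
  haveI := hd
  exact G.separatingCoverings_of_twoComponentUnmarked' hne hprime ι hι hg₀ hs hr hst₀ hg₁ e hC v₀ v₁ hV ε hε
    hV₀ hV₁ n₀ hN hE hgen₀ hgen₁

/-- **F-2830 ∧ F-0459 ∧ F-0438 at EVERY origin of two-component data with `C₁` unmarked, `r ≥ 1`** (the
latter two are gen 5's `twoComponentUnmarkedOrigin_prop12_holds`). [cite: MochizukiCombGC2007, Prop 1.2 pp.8-9] -/
theorem twoComponentUnmarkedOrigin_prop12_rows'
    (hΩ : ∀ ⦃Q : Type⦄ [Group Q] [TopologicalSpace Q] [IsTopologicalGroup Q] (G : PSCDatum Q),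
      Ω.IsOfPSCType G → CompactSpace Q ∧ T2Space Q ∧ TotallyDisconnectedSpace Q ∧
        ∃ (S : Set ℕ) (g r g₀ s : ℕ) (ι : PuncturedSurfaceGroup g r →* Q) (e : G.graph.C ≃ Fin r)
          (v₀ v₁ : G.graph.V) (n₀ : G.graph.N) (ε : PuncturedSurfaceGroup g r),
          S.Nonempty ∧ (∀ p ∈ S, p.Prime) ∧ IsProSigmaCompletion S ι ∧ g₀ ≤ g ∧ s = 0 ∧ 1 ≤ r ∧
          (1 ≤ g₀ ∨ 2 ≤ r) ∧ 1 ≤ g - g₀ ∧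
          (∀ c, G.cuspGp c =
            ((PuncturedSurfaceGroup.cuspInertia (g := g) (e c)).map ι).topologicalClosure) ∧
          (∀ w, w = v₀ ∨ w = v₁) ∧ (∀ n, n = n₀) ∧
          ε = ((List.finRange r).map fun j : Fin r =>
            if s ≤ (j : ℕ) then PuncturedSurfaceGroup.c (g := g) j else 1).prod *
          ((List.finRange g).map fun i : Fin g => if (i : ℕ) < g₀ then
            PuncturedSurfaceGroup.a (r := r) i * PuncturedSurfaceGroup.b i *
              (PuncturedSurfaceGroup.a i)⁻¹ * (PuncturedSurfaceGroup.b i)⁻¹ else 1).prod ∧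
          G.vertGp v₀ = ((Subgroup.closure {x : PuncturedSurfaceGroup g r |
            (∃ i : Fin g, (i : ℕ) < g₀ ∧ (x = PuncturedSurfaceGroup.a i ∨ x = PuncturedSurfaceGroup.b i)) ∨
            ∃ j : Fin r, s ≤ (j : ℕ) ∧ x = PuncturedSurfaceGroup.c j}).map ι).topologicalClosure ∧
          G.vertGp v₁ = ((Subgroup.closure {x : PuncturedSurfaceGroup g r |
            (∃ i : Fin g, g₀ ≤ (i : ℕ) ∧ (x = PuncturedSurfaceGroup.a i ∨ x = PuncturedSurfaceGroup.b i)) ∨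
            (∃ j : Fin r, (j : ℕ) < s ∧ x = PuncturedSurfaceGroup.c j) ∨ x = ε}).map ι).topologicalClosure ∧
          G.nodeGp n₀ = ((Subgroup.zpowers ε).map ι).topologicalClosure ∧
          G.genus v₀ = g₀ ∧ G.genus v₁ = g - g₀) :
    SeparatingCoveringsHolds Ω ∧ OpenInterDeterminesComponentHolds Ω ∧ CommensurableTerminalityHolds Ω :=
  ⟨twoComponentUnmarkedOrigin_separatingCoveringsHolds' Ω hΩ, twoComponentUnmarkedOrigin_prop12_holds Ω hΩ⟩

end Origin

/-- **Non-vacuity at the corner: F-2830 ∧ F-0459 ∧ F-0438 at the INHABITED origin of the two-component data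
with `C₁` unmarked and ONE marked point** (`Γ_{2,1}`, genera `(1,1)`, the marked point on `C₀`; profinite
pro-`Σ` completions in `Type`, any nonempty set `Σ` of primes; abc-iut-f-164's `exists_twoComponentAffineDatum`).
[cite: MochizukiCombGC2007, Prop 1.2 pp.8-9] -/
theorem exists_twoComponentUnmarkedOrigin_prop12_rows_oneCusp (Sigma : Set ℕ) (hne : Sigma.Nonempty)
    (hprime : ∀ p ∈ Sigma, p.Prime) :
    ∃ Ω : PSCOrigin.{0},
      (∃ (Q : ProfiniteGrp.{0}) (G : PSCDatum Q), Ω.IsOfPSCType G ∧ G.Sigma = Sigma ∧ G.graph.i = 2 ∧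
        G.graph.n = 1 ∧ G.graph.r = 1 ∧ ∀ v, G.genus v = 1) ∧
      SeparatingCoveringsHolds Ω ∧ OpenInterDeterminesComponentHolds Ω ∧
        CommensurableTerminalityHolds Ω := by
  classical
  let Ω : PSCOrigin.{0} :=
    ⟨fun {Q} _ _ G => ∃ (_ : IsTopologicalGroup Q), CompactSpace Q ∧ T2Space Q ∧
      TotallyDisconnectedSpace Q ∧
      ∃ (S : Set ℕ) (g r g₀ s : ℕ) (ι : PuncturedSurfaceGroup g r →* Q) (e : G.graph.C ≃ Fin r)
        (v₀ v₁ : G.graph.V) (n₀ : G.graph.N) (ε : PuncturedSurfaceGroup g r),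
        S.Nonempty ∧ (∀ p ∈ S, p.Prime) ∧ IsProSigmaCompletion S ι ∧ g₀ ≤ g ∧ s = 0 ∧ 1 ≤ r ∧
        (1 ≤ g₀ ∨ 2 ≤ r) ∧ 1 ≤ g - g₀ ∧
        (∀ c, G.cuspGp c =
          ((PuncturedSurfaceGroup.cuspInertia (g := g) (e c)).map ι).topologicalClosure) ∧
        (∀ w, w = v₀ ∨ w = v₁) ∧ (∀ n, n = n₀) ∧
        ε = ((List.finRange r).map fun j : Fin r =>
          if s ≤ (j : ℕ) then PuncturedSurfaceGroup.c (g := g) j else 1).prod *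
        ((List.finRange g).map fun i : Fin g => if (i : ℕ) < g₀ then
          PuncturedSurfaceGroup.a (r := r) i * PuncturedSurfaceGroup.b i *
            (PuncturedSurfaceGroup.a i)⁻¹ * (PuncturedSurfaceGroup.b i)⁻¹ else 1).prod ∧
        G.vertGp v₀ = ((Subgroup.closure {x : PuncturedSurfaceGroup g r |
          (∃ i : Fin g, (i : ℕ) < g₀ ∧ (x = PuncturedSurfaceGroup.a i ∨ x = PuncturedSurfaceGroup.b i)) ∨
          ∃ j : Fin r, s ≤ (j : ℕ) ∧ x = PuncturedSurfaceGroup.c j}).map ι).topologicalClosure ∧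
        G.vertGp v₁ = ((Subgroup.closure {x : PuncturedSurfaceGroup g r |
          (∃ i : Fin g, g₀ ≤ (i : ℕ) ∧ (x = PuncturedSurfaceGroup.a i ∨ x = PuncturedSurfaceGroup.b i)) ∨
          (∃ j : Fin r, (j : ℕ) < s ∧ x = PuncturedSurfaceGroup.c j) ∨ x = ε}).map ι).topologicalClosure ∧
        G.nodeGp n₀ = ((Subgroup.zpowers ε).map ι).topologicalClosure ∧
        G.genus v₀ = g₀ ∧ G.genus v₁ = g - g₀⟩
  have hΩ : ∀ ⦃Q : Type⦄ [Group Q] [TopologicalSpace Q] [IsTopologicalGroup Q] (G : PSCDatum Q),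
      Ω.IsOfPSCType G → CompactSpace Q ∧ T2Space Q ∧ TotallyDisconnectedSpace Q ∧
        ∃ (S : Set ℕ) (g r g₀ s : ℕ) (ι : PuncturedSurfaceGroup g r →* Q) (e : G.graph.C ≃ Fin r)
          (v₀ v₁ : G.graph.V) (n₀ : G.graph.N) (ε : PuncturedSurfaceGroup g r),
          S.Nonempty ∧ (∀ p ∈ S, p.Prime) ∧ IsProSigmaCompletion S ι ∧ g₀ ≤ g ∧ s = 0 ∧ 1 ≤ r ∧
          (1 ≤ g₀ ∨ 2 ≤ r) ∧ 1 ≤ g - g₀ ∧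
          (∀ c, G.cuspGp c =
            ((PuncturedSurfaceGroup.cuspInertia (g := g) (e c)).map ι).topologicalClosure) ∧
          (∀ w, w = v₀ ∨ w = v₁) ∧ (∀ n, n = n₀) ∧
          ε = ((List.finRange r).map fun j : Fin r =>
            if s ≤ (j : ℕ) then PuncturedSurfaceGroup.c (g := g) j else 1).prod *
          ((List.finRange g).map fun i : Fin g => if (i : ℕ) < g₀ then
            PuncturedSurfaceGroup.a (r := r) i * PuncturedSurfaceGroup.b i *
              (PuncturedSurfaceGroup.a i)⁻¹ * (PuncturedSurfaceGroup.b i)⁻¹ else 1).prod ∧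
          G.vertGp v₀ = ((Subgroup.closure {x : PuncturedSurfaceGroup g r |
            (∃ i : Fin g, (i : ℕ) < g₀ ∧ (x = PuncturedSurfaceGroup.a i ∨ x = PuncturedSurfaceGroup.b i)) ∨
            ∃ j : Fin r, s ≤ (j : ℕ) ∧ x = PuncturedSurfaceGroup.c j}).map ι).topologicalClosure ∧
          G.vertGp v₁ = ((Subgroup.closure {x : PuncturedSurfaceGroup g r |
            (∃ i : Fin g, g₀ ≤ (i : ℕ) ∧ (x = PuncturedSurfaceGroup.a i ∨ x = PuncturedSurfaceGroup.b i)) ∨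
            (∃ j : Fin r, (j : ℕ) < s ∧ x = PuncturedSurfaceGroup.c j) ∨ x = ε}).map ι).topologicalClosure ∧
          G.nodeGp n₀ = ((Subgroup.zpowers ε).map ι).topologicalClosure ∧
          G.genus v₀ = g₀ ∧ G.genus v₁ = g - g₀ := by
    intro Q _ _ _ G hG
    obtain ⟨_, h⟩ := hG
    exact h
  refine ⟨Ω, ?_, twoComponentUnmarkedOrigin_prop12_rows' Ω hΩ⟩
  obtain ⟨Q, ι, G, e, v₀, v₁, n₀, ε, hι, hSg, hi, hn, hr, hC, hV, hN, hε, hV₀, hV₁, hE, hg₀, hg₁, -⟩ :=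
    exists_twoComponentAffineDatum Sigma hne hprime 2 1 1 0
  have hgen : ∀ v, G.genus v = 1 := fun v => by
    rcases hV v with rfl | rfl
    · exact hg₀
    · exact hg₁
  refine ⟨Q, G, ?_, hSg, hi, hn, hr, hgen⟩
  exact ⟨inferInstance, inferInstance, inferInstance, inferInstance, Sigma, 2, 1, 1, 0, ι, e, v₀, v₁, n₀, ε,
    hne, hprime, hι, by norm_num, rfl, le_rfl, Or.inl le_rfl, by norm_num, hC, hV, hN, hε, hV₀, hV₁, hE,
    hg₀, hg₁⟩

end PSCDatum

end Literature.AnabelianGeometry.SemiGraphs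

end
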